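import Summits.AtomisticToContinuum.Crystallization.Theorems.ChargedEnergyGapFlatUnit
import HarnessLib

/-!
# (T¹ᶜ) station certificates — NODE 113V-A «RhoCovariantA»: the ρ-covariant cap comparison, cell and station level (lens-3 g98; file 1 of 2)

decomp-a2c lens-3 g98.  Line of record `stmt-AtomisticToContinuum-14231` (route PricedLinkCensus r3), deciding leaf
(T¹ᶜ) `StencilChartLawQ 130 (1/60000000) 160 (3/100) (679/1000) (691/1000)`; residual of record = 7 zone laws + the ridge atlas
(113S `stencilChartLawQ_designate_of_residual`), whose leaves close from landed 113L `ZUnit` laws.  SPLIT-400 edition of NODE 113V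
(crit-1 r1925 (B)): this file = §113V.1–§113V.4 (glue, cap cell, cost-cell block, station level); `ChargedEnergyGapRhoCovariant` = §113V.5–§113V.7
(unit level, subsumption, audit) imports it.  The mathematics, the finding «RHO-LOSS» and the emitter patch are documented THERE in full; in short:

every checker of record prices the cost at `(τ·2ρ₁)²` (top of the ρ-slab) but certifies the cap at `(τ·2ρ₀)²` (bottom), losing `(ρ₁/ρ₀)²`
per slab although `cost(ρ, dt) = (τ·2ρ)²·roofVal(vtxW dt)` EXACTLY; comparing at `ρ₁` on BOTH sides (`feetHoleCost_le_sq_ratio`,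
★ `capCell_lower_cov`, `CostCellCert.capCheckCov(_sound)`, `StationCert.checkDXZCov` / ★★ `sound_dietXZCov` with 113L `sound_dietXZ`'s
binders and conclusion VERBATIM) is the sharp form given the cell certificates.

## Contents (TWINS of the 113L stack with the one-token change `rho0 ↦ rho1` in the cap arithmetic)

* §113V.1 glue: `domCapK_nonneg`, `feetHoleCost_le_sq_ratio`, `ratio_mul_le`, `sq_ratio_le_one`.
* §113V.2 `capCell_core` (NODE 99's replay up to the weight sum, once) and ★ `capCell_lower_cov`.
* §113V.3 108C twin: `CostCellCert.capCheckCov` / `capCheckCov_sound`; NODE 112 twin `capCheckCov_zero_chamber`.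
* §113V.4 113L twins: `StationCert.checkDXZCov`, `sound_leafGCov`, ★★ `sound_dietXZCov`, `sphLaw_of_checkDXZCov`.

No `sorry`; axioms = the standard triple.
-/

namespace Summit.AtomisticToContinuum.Crystallization.Theorems.ChargedEnergyGapChartDial

open scoped Classical
open Literature.MathematicalPhysics.StatisticalMechanics Literature.Geometry.DiscreteGeometry
open Summit.AtomisticToContinuum.Crystallization.Theses.PricedLinkCensus
open Summit.AtomisticToContinuum.Crystallization.Theorems.ChargedEnergyGapNegative

/-! ## §113V.1 Glue: the exact ρ-covariance of the cost, non-negativity of the cap -/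
section Glue

/-- ★ The cap is non-negative for a non-negative unit. -/
theorem domCapK_nonneg {unit : ℝ} (hu : 0 ≤ unit) (ϱ τ ρ d : ℝ) : 0 ≤ domCapK unit ϱ τ ρ d := by
  unfold domCapK
  have hκ : 1 ≤ domKappa d := one_le_domKappa d
  have h1 : 0 ≤ domKappa d * (103 / 100 * ((τ * (2 * ρ)) ^ 2 * roofVal T75 (tiltSext ϱ ρ d))) :=
    mul_nonneg (by linarith) (mul_nonneg (by norm_num) (mul_nonneg (sq_nonneg _) (roofVal_T75_nonneg _)))
  have h2 := le_max_left (domKappa d * (103 / 100 * ((τ * (2 * ρ)) ^ 2 * roofVal T75 (tiltSext ϱ ρ d))))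
    (if (241 / 2 : ℝ) ≤ d then 45 * unit else 0)
  nlinarith

/-- ★ EXACT ρ-COVARIANCE OF THE COST, in the form used downstream: for `0 ≤ ρ`, `0 < ρ₁`,
`cost(ρ, dt) ≤ (ρ/ρ₁)²·((τ·2ρ₁)²·roofVal T75 (vtxW ϱ dt 0))` (an equality, by `feetHoleCost_eq_roofVal`). -/
theorem feetHoleCost_le_sq_ratio {ϱ τ ρ ρ₁ : ℝ} {d : (Fin 3 → ℤ) → ℝ} (hρ₁ : 0 < ρ₁) :
    feetHoleCost ϱ τ ρ d 0 ≤ (ρ / ρ₁) ^ 2 * ((τ * (2 * ρ₁)) ^ 2 * roofVal T75 (vtxW ϱ d 0)) := by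
  rw [feetHoleCost_eq_roofVal]
  have hne : ρ₁ ≠ 0 := hρ₁.ne'
  have e : (τ * (2 * ρ)) ^ 2 = (ρ / ρ₁) ^ 2 * (τ * (2 * ρ₁)) ^ 2 := by
    field_simp
  rw [e, mul_assoc]

/-- ★ `r·x ≤ D` from `x ≤ D`, `0 ≤ D` and `0 ≤ r ≤ 1` (the sign of `x` is free). -/
theorem ratio_mul_le {r x D : ℝ} (hr0 : 0 ≤ r) (hr1 : r ≤ 1) (hD : 0 ≤ D) (h : x ≤ D) : r * x ≤ D := by
  rcases le_total 0 x with hx | hx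
  · exact (mul_le_of_le_one_left hx hr1).trans h
  · exact (mul_nonpos_iff.2 (Or.inl ⟨hr0, hx⟩)).trans hD

/-- ★ `0 ≤ (ρ/ρ₁)² ≤ 1` on the slab. -/
theorem sq_ratio_le_one {ρ ρ₁ : ℝ} (hρ : 0 ≤ ρ) (hρ₁ : ρ ≤ ρ₁) : (ρ / ρ₁) ^ 2 ≤ 1 := by
  rcases eq_or_lt_of_le (hρ.trans hρ₁) with h | h
  · rw [← h]; simp
  · rw [div_pow, div_le_one (pow_pos h 2)]
    exact pow_le_pow_left₀ hρ hρ₁ 2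

end Glue

/-! ## §113V.2 The ρ-covariant cap cell (NODE 99 twin) -/
section CapCell

/-- ★★ THE CORE OF NODE 99, replayed once: from the cell certificates (geometry, pole row, three tilt rows, the dual-feasible price with the y⋆
sign pattern, the affine minorant `≥ Bmin ≥ 0` at the four corners), for every `(ρ, t)` of the cell the cap dominates
`κ(hi)·(u/10 + 1.03·(τ·2ρ)²·Bmin)` — the prefactor at the TRUE `ρ`. -/
theorem capCell_core {u ρ₀ ρ₁ a lo hi dlo dhi p₀ p₁ : ℝ}
    {rA₁ uA₁ rL₁ lL₁ l₀₁ l₁₁ rA₂ uA₂ rL₂ lL₂ l₀₂ l₁₂ rA₃ uA₃ rL₃ lL₃ l₀₃ l₁₃ : ℝ}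
    {y0T y0F y1T y1F y2T y2F Bmin : ℝ}
    (hg : CapCellGeom ρ₀ ρ₁ a lo hi dlo dhi) (hP : PoleRowCert dlo dhi p₀ p₁)
    (hT₁ : TiltRowCert (439 / 485) ρ₀ ρ₁ a lo hi rA₁ uA₁ rL₁ lL₁ l₀₁ l₁₁)
    (hT₂ : TiltRowCert (527 / 485) ρ₀ ρ₁ a lo hi rA₂ uA₂ rL₂ lL₂ l₀₂ l₁₂)
    (hT₃ : TiltRowCert (483 / 485) ρ₀ ρ₁ a lo hi rA₃ uA₃ rL₃ lL₃ l₀₃ l₁₃)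
    (hy : IsRoofDualFeasible T75 (sext y0T y0F y1T y1F y2T y2F))
    (hs₀ : y0T + y0F ≤ 0) (hs₁ : 0 ≤ y1T) (hs₂ : 0 ≤ y1F) (hs₃ : 0 ≤ y2T + y2F) (hB : 0 ≤ Bmin)
    (hc₀₀ : Bmin ≤ capMinorant (y0T + y0F) y1T y1F (y2T + y2F) p₀ p₁ l₀₁ l₁₁ l₀₂ l₁₂ l₀₃ l₁₃ lo ρ₀)
    (hc₀₁ : Bmin ≤ capMinorant (y0T + y0F) y1T y1F (y2T + y2F) p₀ p₁ l₀₁ l₁₁ l₀₂ l₁₂ l₀₃ l₁₃ lo ρ₁)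
    (hc₁₀ : Bmin ≤ capMinorant (y0T + y0F) y1T y1F (y2T + y2F) p₀ p₁ l₀₁ l₁₁ l₀₂ l₁₂ l₀₃ l₁₃ hi ρ₀)
    (hc₁₁ : Bmin ≤ capMinorant (y0T + y0F) y1T y1F (y2T + y2F) p₀ p₁ l₀₁ l₁₁ l₀₂ l₁₂ l₀₃ l₁₃ hi ρ₁)
    (hu : 0 ≤ u) :
    ∀ ρ t : ℝ, ρ₀ ≤ ρ → ρ ≤ ρ₁ → lo ≤ t → t ≤ hi →
      max 1 (min 2 ((116 - hi) / 3)) * (u / 10 + 103 / 100 * ((3 / 100 * (2 * ρ)) ^ 2 * Bmin)) ≤ domCapK u 160 (3 / 100) ρ t := by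
  intro ρ t hρ hρ' ht ht'
  obtain ⟨hρ₀, hρ₀₁, ha, halo, hlohi, hdlo, hdlt, hdhi, hd₀, hd₁⟩ := hg
  have hE6 := domCapK_ge_of_dualFeasible u 160 (3 / 100) ρ t hy
  rw [sum_six] at hE6
  obtain ⟨e0, e1, e2, e3, e4, e5⟩ := sext_apply_six y0T y0F y1T y1F y2T y2F
  rw [e0, e1, e2, e3, e4, e5] at hE6
  obtain ⟨w0, w1, w2, w3, w4, w5⟩ := tiltSext_apply 160 ρ t
  rw [w0, w1, w2, w3, w4, w5] at hE6
  have hpole := pole_row_cell hdlo hdlt hdhi hP (t - ρ) (by linarith) (by linarith)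
  have r₁ := tilt_row_cell (by norm_num) (by norm_num) (by norm_num) hρ₀ ha halo hlohi hT₁ hρ hρ' ht ht'
  have r₂ := tilt_row_cell (by norm_num) (by norm_num) (by norm_num) hρ₀ ha halo hlohi hT₂ hρ hρ' ht ht'
  have r₃ := tilt_row_cell (by norm_num) (by norm_num) (by norm_num) hρ₀ ha halo hlohi hT₃ hρ hρ' ht ht'
  have t₀ := mul_le_mul_of_nonpos_left hpole hs₀
  have t₁ := mul_le_mul_of_nonneg_left r₁ hs₁
  have t₂ := mul_le_mul_of_nonneg_left r₂ hs₂
  have t₃ := mul_le_mul_of_nonneg_left r₃ hs₃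
  have hSum : capMinorant (y0T + y0F) y1T y1F (y2T + y2F) p₀ p₁ l₀₁ l₁₁ l₀₂ l₁₂ l₀₃ l₁₃ t ρ ≤
      y0T * depthProfile 160 (t - ρ) + y0F * depthProfile 160 (t - ρ) +
      y1T * depthProfile 160 (Real.sqrt (tiltArg (439 / 485) ρ t)) + y1F * depthProfile 160 (Real.sqrt (tiltArg (527 / 485) ρ t)) +
      y2T * depthProfile 160 (Real.sqrt (tiltArg (483 / 485) ρ t)) + y2F * depthProfile 160 (Real.sqrt (tiltArg (483 / 485) ρ t)) := by
    unfold capMinorant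
    linarith [t₀, t₁, t₂, t₃]
  have e : ∀ t' x : ℝ, capMinorant (y0T + y0F) y1T y1F (y2T + y2F) p₀ p₁ l₀₁ l₁₁ l₀₂ l₁₂ l₀₃ l₁₃ t' x =
      ((y0T + y0F) * p₀ + y1T * l₀₁ + y1F * l₀₂ + (y2T + y2F) * l₀₃) + ((y0T + y0F) * p₁ + y1T * l₁₁ + y1F * l₁₂ + (y2T + y2F) * l₁₃) * t' +
        (-((y0T + y0F) * p₁)) * x := by
    intro t' x; unfold capMinorant; ring
  have hmin : Bmin ≤ capMinorant (y0T + y0F) y1T y1F (y2T + y2F) p₀ p₁ l₀₁ l₁₁ l₀₂ l₁₂ l₀₃ l₁₃ t ρ := by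
    rw [e] at hc₀₀ hc₀₁ hc₁₀ hc₁₁ ⊢
    exact affine_ge_on_box hc₀₀ hc₀₁ hc₁₀ hc₁₁ ht ht' hρ hρ'
  have hSum2 := hmin.trans hSum
  generalize hS : (y0T * depthProfile 160 (t - ρ) + y0F * depthProfile 160 (t - ρ) +
      y1T * depthProfile 160 (Real.sqrt (tiltArg (439 / 485) ρ t)) + y1F * depthProfile 160 (Real.sqrt (tiltArg (527 / 485) ρ t)) +
      y2T * depthProfile 160 (Real.sqrt (tiltArg (483 / 485) ρ t)) + y2F * depthProfile 160 (Real.sqrt (tiltArg (483 / 485) ρ t))) = S at hE6 hSum2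
  have hprod : (3 / 100 * (2 * ρ)) ^ 2 * Bmin ≤ (3 / 100 * (2 * ρ)) ^ 2 * S := mul_le_mul_of_nonneg_left hSum2 (sq_nonneg _)
  have hB₀ : 0 ≤ (3 / 100 * (2 * ρ)) ^ 2 * Bmin := mul_nonneg (sq_nonneg _) hB
  have hX : 0 ≤ u / 10 + 103 / 100 * ((3 / 100 * (2 * ρ)) ^ 2 * S) := by linarith
  have hk₀ : (0 : ℝ) ≤ max 1 (min 2 ((116 - hi) / 3)) := le_trans zero_le_one (le_max_left _ _)
  calc max 1 (min 2 ((116 - hi) / 3)) * (u / 10 + 103 / 100 * ((3 / 100 * (2 * ρ)) ^ 2 * Bmin))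
      ≤ max 1 (min 2 ((116 - hi) / 3)) * (u / 10 + 103 / 100 * ((3 / 100 * (2 * ρ)) ^ 2 * S)) :=
        mul_le_mul_of_nonneg_left (by linarith) hk₀
    _ ≤ domKappa t * (u / 10 + 103 / 100 * ((3 / 100 * (2 * ρ)) ^ 2 * S)) := mul_le_mul_of_nonneg_right (domKappa_ge_hi ht') hX
    _ = domKappa t * (u / 10) + domKappa t * (103 / 100 * ((3 / 100 * (2 * ρ)) ^ 2 * S)) := by ring
    _ ≤ domCapK u 160 (3 / 100) ρ t := hE6

/-- ★★★ **THE ρ-COVARIANT CAP CELL**: the hypotheses of NODE 99 `capCell_lower` with the final arithmetic taken at `ρ₁` —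
`capLB·u ≤ κ(hi)·(u/10 + 1.03·(0.06ρ₁)²·Bmin)` — give `(ρ/ρ₁)²·capLB·u ≤ domCapK u … ρ t` on the whole cell (`0 < ρ`). -/
theorem capCell_lower_cov {u ρ₀ ρ₁ a lo hi dlo dhi p₀ p₁ : ℝ}
    {rA₁ uA₁ rL₁ lL₁ l₀₁ l₁₁ rA₂ uA₂ rL₂ lL₂ l₀₂ l₁₂ rA₃ uA₃ rL₃ lL₃ l₀₃ l₁₃ : ℝ}
    {y0T y0F y1T y1F y2T y2F Bmin capLB : ℝ}
    (hg : CapCellGeom ρ₀ ρ₁ a lo hi dlo dhi) (hP : PoleRowCert dlo dhi p₀ p₁)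
    (hT₁ : TiltRowCert (439 / 485) ρ₀ ρ₁ a lo hi rA₁ uA₁ rL₁ lL₁ l₀₁ l₁₁)
    (hT₂ : TiltRowCert (527 / 485) ρ₀ ρ₁ a lo hi rA₂ uA₂ rL₂ lL₂ l₀₂ l₁₂)
    (hT₃ : TiltRowCert (483 / 485) ρ₀ ρ₁ a lo hi rA₃ uA₃ rL₃ lL₃ l₀₃ l₁₃)
    (hy : IsRoofDualFeasible T75 (sext y0T y0F y1T y1F y2T y2F))
    (hs₀ : y0T + y0F ≤ 0) (hs₁ : 0 ≤ y1T) (hs₂ : 0 ≤ y1F) (hs₃ : 0 ≤ y2T + y2F) (hB : 0 ≤ Bmin)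
    (hc₀₀ : Bmin ≤ capMinorant (y0T + y0F) y1T y1F (y2T + y2F) p₀ p₁ l₀₁ l₁₁ l₀₂ l₁₂ l₀₃ l₁₃ lo ρ₀)
    (hc₀₁ : Bmin ≤ capMinorant (y0T + y0F) y1T y1F (y2T + y2F) p₀ p₁ l₀₁ l₁₁ l₀₂ l₁₂ l₀₃ l₁₃ lo ρ₁)
    (hc₁₀ : Bmin ≤ capMinorant (y0T + y0F) y1T y1F (y2T + y2F) p₀ p₁ l₀₁ l₁₁ l₀₂ l₁₂ l₀₃ l₁₃ hi ρ₀)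
    (hc₁₁ : Bmin ≤ capMinorant (y0T + y0F) y1T y1F (y2T + y2F) p₀ p₁ l₀₁ l₁₁ l₀₂ l₁₂ l₀₃ l₁₃ hi ρ₁)
    (hu : 0 ≤ u) (hcap : capLB * u ≤ max 1 (min 2 ((116 - hi) / 3)) * (u / 10 + 103 / 100 * ((3 / 100 * (2 * ρ₁)) ^ 2 * Bmin))) :
    ∀ ρ t : ℝ, 0 < ρ → ρ₀ ≤ ρ → ρ ≤ ρ₁ → lo ≤ t → t ≤ hi → (ρ / ρ₁) ^ 2 * (capLB * u) ≤ domCapK u 160 (3 / 100) ρ t := by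
  intro ρ t hρpos hρ hρ' ht ht'
  have hcore := capCell_core hg hP hT₁ hT₂ hT₃ hy hs₀ hs₁ hs₂ hs₃ hB hc₀₀ hc₀₁ hc₁₀ hc₁₁ hu ρ t hρ hρ' ht ht'
  have hρ₁ : 0 < ρ₁ := lt_of_lt_of_le hρpos hρ'
  have hr0 : 0 ≤ (ρ / ρ₁) ^ 2 := sq_nonneg _
  have hr1 : (ρ / ρ₁) ^ 2 ≤ 1 := sq_ratio_le_one hρpos.le hρ'
  have hne : ρ₁ ≠ 0 := hρ₁.ne'
  have e : (ρ / ρ₁) ^ 2 * (3 / 100 * (2 * ρ₁)) ^ 2 = (3 / 100 * (2 * ρ)) ^ 2 := by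
    field_simp
  have hk₀ : (0 : ℝ) ≤ max 1 (min 2 ((116 - hi) / 3)) := le_trans zero_le_one (le_max_left _ _)
  have hB₀ : 0 ≤ (3 / 100 * (2 * ρ)) ^ 2 * Bmin := mul_nonneg (sq_nonneg _) hB
  have hu10 : (ρ / ρ₁) ^ 2 * (u / 10) ≤ u / 10 := mul_le_of_le_one_left (by linarith) hr1
  calc (ρ / ρ₁) ^ 2 * (capLB * u)
      ≤ (ρ / ρ₁) ^ 2 * (max 1 (min 2 ((116 - hi) / 3)) * (u / 10 + 103 / 100 * ((3 / 100 * (2 * ρ₁)) ^ 2 * Bmin))) :=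
        mul_le_mul_of_nonneg_left hcap hr0
    _ = max 1 (min 2 ((116 - hi) / 3)) * ((ρ / ρ₁) ^ 2 * (u / 10) + 103 / 100 * (((ρ / ρ₁) ^ 2 * (3 / 100 * (2 * ρ₁)) ^ 2) * Bmin)) := by
        ring
    _ = max 1 (min 2 ((116 - hi) / 3)) * ((ρ / ρ₁) ^ 2 * (u / 10) + 103 / 100 * ((3 / 100 * (2 * ρ)) ^ 2 * Bmin)) := by rw [e]
    _ ≤ max 1 (min 2 ((116 - hi) / 3)) * (u / 10 + 103 / 100 * ((3 / 100 * (2 * ρ)) ^ 2 * Bmin)) :=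
        mul_le_mul_of_nonneg_left (by linarith) hk₀
    _ ≤ domCapK u 160 (3 / 100) ρ t := hcore

end CapCell

/-! ## §113V.3 The ρ-covariant cap block of a cost cell (108C twin) and its chamber form (NODE 112 twin) -/
section Block

/-- ★ The ρ-COVARIANT CAP block of axis `a`: 108C `capCheck` verbatim except the final arithmetic, taken at `rho1`. -/
def CostCellCert.capCheckCov (c : CostCellCert) (a : Fin 3) : Bool :=
  let k := c.cap a
  if k.kind = 0 then decide (c.hi (k.wit, true) + c.hi (k.wit, false) < c.lo (a, true) + c.lo (a, false))
  else if k.kind = 1 then decide (241 / 2 ≤ c.tlo a ∧ c.capLB ≤ 451 / 10 ∧ 0 ≤ c.u)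
  else
    capGeomCheck c.rho0 c.rho1 k.anc (c.tlo a) (c.thi a) k.dlo k.dhi && poleRowCheck k.dlo k.dhi k.p₀ k.p₁ &&
    c.tiltOK a k (439 / 485) k.t₁ && c.tiltOK a k (527 / 485) k.t₂ && c.tiltOK a k (483 / 485) k.t₃ &&
    decide (0 ≤ k.Bmin ∧ 0 ≤ c.u ∧
      k.Bmin ≤ capMinorantQ (-(781 / 6000) + -(763 / 6000)) (955 / 18000) (32647 / 450000) (917 / 18000 + 917 / 18000)
        k.p₀ k.p₁ k.t₁.l₀ k.t₁.l₁ k.t₂.l₀ k.t₂.l₁ k.t₃.l₀ k.t₃.l₁ (c.tlo a) c.rho0 ∧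
      k.Bmin ≤ capMinorantQ (-(781 / 6000) + -(763 / 6000)) (955 / 18000) (32647 / 450000) (917 / 18000 + 917 / 18000)
        k.p₀ k.p₁ k.t₁.l₀ k.t₁.l₁ k.t₂.l₀ k.t₂.l₁ k.t₃.l₀ k.t₃.l₁ (c.tlo a) c.rho1 ∧
      k.Bmin ≤ capMinorantQ (-(781 / 6000) + -(763 / 6000)) (955 / 18000) (32647 / 450000) (917 / 18000 + 917 / 18000)
        k.p₀ k.p₁ k.t₁.l₀ k.t₁.l₁ k.t₂.l₀ k.t₂.l₁ k.t₃.l₀ k.t₃.l₁ (c.thi a) c.rho0 ∧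
      k.Bmin ≤ capMinorantQ (-(781 / 6000) + -(763 / 6000)) (955 / 18000) (32647 / 450000) (917 / 18000 + 917 / 18000)
        k.p₀ k.p₁ k.t₁.l₀ k.t₁.l₁ k.t₂.l₀ k.t₂.l₁ k.t₃.l₀ k.t₃.l₁ (c.thi a) c.rho1 ∧
      c.capLB * c.u ≤ kappaQ (c.thi a) * (c.u / 10 + 103 / 100 * ((3 / 100 * (2 * c.rho1)) ^ 2 * k.Bmin)))

/-- ★★ Soundness of the ρ-covariant cap block: for `0 < ρ' ∈ [rho0, rho1]` and `t` in the block's range, `(ρ'/rho1)²·capLB·u ≤ domCapK u … ρ' t`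
(vacuous by the witness axis; floor by `domCapK_ge_floor`; cap cell by `capCell_lower_cov`). -/
theorem CostCellCert.capCheckCov_sound (c : CostCellCert) (a : Fin 3) (h : c.capCheckCov a = true) :
    (∀ b : Fin 3, castW c.lo (a, true) + castW c.lo (a, false) ≤ castW c.hi (b, true) + castW c.hi (b, false)) →
    ∀ ρ' t : ℝ, 0 < ρ' → (c.rho0 : ℝ) ≤ ρ' → ρ' ≤ c.rho1 → (castW c.lo (a, true) + castW c.lo (a, false)) / 2 + c.rho0 ≤ t →
      t ≤ (castW c.hi (a, true) + castW c.hi (a, false)) / 2 + c.rho1 →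
      (ρ' / c.rho1) ^ 2 * ((c.capLB : ℝ) * c.u) ≤ domCapK c.u 160 (3 / 100) ρ' t := by
  intro hb ρ' t hρ' h₀ h₁ ht₀ ht₁
  have htlo : ((c.tlo a : ℚ) : ℝ) ≤ t := by unfold CostCellCert.tlo; push_cast; exact ht₀
  have hthi : t ≤ ((c.thi a : ℚ) : ℝ) := by unfold CostCellCert.thi; push_cast; exact ht₁
  have hr0 : 0 ≤ (ρ' / (c.rho1 : ℝ)) ^ 2 := sq_nonneg _
  have hr1 : (ρ' / (c.rho1 : ℝ)) ^ 2 ≤ 1 := sq_ratio_le_one hρ'.le h₁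
  unfold CostCellCert.capCheckCov at h
  simp only at h
  split_ifs at h with hk0 hk1
  · have hlt := qlt (decide_eq_true_eq.mp h); push_cast at hlt
    exact absurd (hb (c.cap a).wit) (not_le.mpr hlt)
  · obtain ⟨h241, h451, hu⟩ := decide_eq_true_eq.mp h
    have hu' : (0 : ℝ) ≤ c.u := by exact_mod_cast hu
    have h241' : (241 / 2 : ℝ) ≤ t := by have := qle h241; push_cast at this; exact this.trans htlo
    have h451' : (c.capLB : ℝ) ≤ 451 / 10 := by have := qle h451; push_cast at this; exact this
    refine ratio_mul_le hr0 hr1 (domCapK_nonneg hu' 160 (3 / 100) ρ' t) ?_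
    calc (c.capLB : ℝ) * c.u ≤ 451 / 10 * c.u := mul_le_mul_of_nonneg_right h451' hu'
      _ ≤ domCapK c.u 160 (3 / 100) ρ' t := domCapK_ge_floor hu' 160 (3 / 100) ρ' h241'
  · simp only [Bool.and_eq_true, CostCellCert.tiltOK] at h
    obtain ⟨⟨⟨⟨⟨hg, hP⟩, hT₁⟩, hT₂⟩, hT₃⟩, hrest⟩ := h
    obtain ⟨hB, hu, hc₀₀, hc₀₁, hc₁₀, hc₁₁, hcap⟩ := decide_eq_true_eq.mp hrest
    refine capCell_lower_cov (capGeomCheck_sound hg) (poleRowCheck_sound hP) (tiltRowCheck_sound (by norm_num) hT₁)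
      (tiltRowCheck_sound (by norm_num) hT₂) (tiltRowCheck_sound (by norm_num) hT₃) isRoofDualFeasible_T75_sext_swap
      (by norm_num) (by norm_num) (by norm_num) (by norm_num) (show (0 : ℝ) ≤ ((c.cap a).Bmin : ℝ) by exact_mod_cast hB) ?_ ?_ ?_ ?_
      (show (0 : ℝ) ≤ (c.u : ℝ) by exact_mod_cast hu) ?_ ρ' t hρ' h₀ h₁ htlo hthi
    · have := qle hc₀₀; rw [cast_capMinorantQ] at this; push_cast at this; exact this
    · have := qle hc₀₁; rw [cast_capMinorantQ] at this; push_cast at this; exact this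
    · have := qle hc₁₀; rw [cast_capMinorantQ] at this; push_cast at this; exact this
    · have := qle hc₁₁; rw [cast_capMinorantQ] at this; push_cast at this; exact this
    · have := qle hcap; push_cast [cast_kappaQ] at this; exact this

/-- ★★ THE ρ-COVARIANT CAP IN THE CHAMBER (NODE 112 `capCheck_zero_chamber` twin): only the axis-0 block is consulted. -/
theorem capCheckCov_zero_chamber {k : CostCellCert} (hk : k.capCheckCov 0 = true) {ρ : ℝ} (hρ : 0 < ρ) (h₀ : (k.rho0 : ℝ) ≤ ρ)
    (h₁ : ρ ≤ k.rho1) {dt : (Fin 3 → ℤ) → ℝ} (hb : ∀ q, castW k.lo q ≤ dt (holeVertex 0 q) ∧ dt (holeVertex 0 q) ≤ castW k.hi q)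
    (hc1 : poleSum dt 0 ≤ poleSum dt 1) (hc2 : poleSum dt 0 ≤ poleSum dt 2) :
    (ρ / k.rho1) ^ 2 * ((k.capLB : ℝ) * k.u) ≤ domCapK k.u 160 (3 / 100) ρ (chargeDepth ρ dt 0) := by
  rw [chargeDepth_of_axisZero hρ hc1 hc2]
  have hle : ∀ b : Fin 3, poleSum dt 0 ≤ poleSum dt b := fun b => by
    fin_cases b
    · exact le_rfl
    · exact hc1
    · exact hc2
  refine k.capCheckCov_sound 0 hk (fun b => ?_) ρ _ hρ h₀ h₁ ?_ ?_
  · have h := hle b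
    unfold poleSum at h
    linarith [(hb (0, true)).1, (hb (0, false)).1, (hb (b, true)).2, (hb (b, false)).2]
  · unfold poleSum; linarith [(hb (0, true)).1, (hb (0, false)).1]
  · unfold poleSum; linarith [(hb (0, true)).2, (hb (0, false)).2]

end Block

/-! ## §113V.4 Station level (113L twins) -/
section Station

/-- ★ THE ρ-COVARIANT FLAT DIET CHECKER: 113L `checkDXZ` with the cap blocks read through `capCheckCov`. -/
def StationCert.checkDXZCov (c : StationCert) (X : DietCert) (extra : List LRow) (Bs : List BasisIdx) : Bool :=
  c.R.ok && decide (0 < c.R.rho0 ∧ 0 ≤ c.R.loC) && c.boxes.all (c.boxCheckZ (flatAll Bs)) &&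
    c.caps.all (fun l => (c.capCertL l).capCheckCov 0) && c.capCert.capCheckCov 0 && X.ok c.R &&
    c.tree.checkBox c.needD c.R.bnd (c.R.rows ++ chamberRows ++ X.rows ++ extra)

/-- ★★ THE ρ-COVARIANT LEAF DISPATCH (113L `sound_leafG` twin): the finishing hypothesis delivers `(ρ/rho1)²·capLB·u ≤ domCapK`, and the cost
is compared through its exact covariance `cost(ρ) = (ρ/rho1)²·(τ·2·rho1)²·roofVal`. -/
theorem StationCert.sound_leafGCov (c : StationCert) (CAPOK : CostCellCert → Prop) {dt : (Fin 3 → ℤ) → ℝ}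
    (hboxes : ∀ b ∈ c.boxes, (∀ capLB : ℚ, ((c.kfac * b.R : ℚ) : ℝ) ≤ ((capLB * c.u : ℚ) : ℝ) → (∀ r ∈ b.need, linAt r.a (sval dt) 0 ≤ (r.b : ℝ)) →
      (3 / 100 * (2 * (c.R.rho1 : ℝ))) ^ 2 * roofVal T75 (vtxW 160 dt 0) ≤ (capLB : ℝ) * c.u) ∧ c.kfac * b.R ≤ c.capLB * c.u)
    (hcaps : ∀ l ∈ c.caps, CAPOK (c.capCertL l)) (hc : CAPOK c.capCert)
    {ρ : ℝ} (hρ : 0 < ρ) (h₁ : ρ ≤ c.R.rho1) (hbox : ∀ q, castW c.R.lo q ≤ dt (holeVertex 0 q) ∧ dt (holeVertex 0 q) ≤ castW c.R.hi q)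
    (hfin : ∀ k : CostCellCert, k.rho0 = c.R.rho0 → k.rho1 = c.R.rho1 → k.u = c.u → CAPOK k →
      (∀ q, castW k.lo q ≤ dt (holeVertex 0 q) ∧ dt (holeVertex 0 q) ≤ castW k.hi q) →
      (ρ / (c.R.rho1 : ℝ)) ^ 2 * ((k.capLB : ℝ) * c.u) ≤ domCapK c.u 160 (3 / 100) ρ (chargeDepth ρ dt 0))
    {π : Leaf} (hπ : ∀ r ∈ c.needD π, linAt r.a (sval dt) 0 ≤ (r.b : ℝ)) :
    feetHoleCost 160 (3 / 100) ρ dt 0 ≤ domCapK c.u 160 (3 / 100) ρ (chargeDepth ρ dt 0) := by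
  have hρ1 : (0 : ℝ) < (c.R.rho1 : ℝ) := lt_of_lt_of_le hρ h₁
  have hcost : feetHoleCost 160 (3 / 100) ρ dt 0 ≤
      (ρ / (c.R.rho1 : ℝ)) ^ 2 * ((3 / 100 * (2 * (c.R.rho1 : ℝ))) ^ 2 * roofVal T75 (vtxW 160 dt 0)) :=
    feetHoleCost_le_sq_ratio (ϱ := 160) (τ := 3 / 100) (d := dt) hρ1
  have finish : ∀ (k : CostCellCert), k.rho0 = c.R.rho0 → k.rho1 = c.R.rho1 → k.u = c.u → CAPOK k →
      (∀ q, castW k.lo q ≤ dt (holeVertex 0 q) ∧ dt (holeVertex 0 q) ≤ castW k.hi q) →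
      (3 / 100 * (2 * (c.R.rho1 : ℝ))) ^ 2 * roofVal T75 (vtxW 160 dt 0) ≤ (k.capLB : ℝ) * c.u →
      feetHoleCost 160 (3 / 100) ρ dt 0 ≤ domCapK c.u 160 (3 / 100) ρ (chargeDepth ρ dt 0) :=
    fun k e0 e1 eu k0 hb hpay =>
      hcost.trans ((mul_le_mul_of_nonneg_left hpay (sq_nonneg _)).trans (hfin k e0 e1 eu k0 hb))
  cases π with
  | cone j =>
    simp only [StationCert.needD] at hπ
    split at hπ
    · exact absurd hπ (not_nilRow _)
    · split at hπ
      · next hB => exact finish c.capCert rfl rfl rfl hc hbox (c.payload_sound hB dt hπ)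
      · exact absurd hπ (not_nilRow _)
  | box j =>
    simp only [StationCert.needD] at hπ
    split at hπ
    · exact absurd hπ (not_nilRow _)
    · next b hb =>
      obtain ⟨hpay, hv⟩ := hboxes b (List.mem_of_getElem? hb)
      exact finish c.capCert rfl rfl rfl hc hbox (hpay _ (qle hv) hπ)
  | coneL j k =>
    simp only [StationCert.needD] at hπ
    split at hπ
    · next B l hB hl =>
      split at hπ
      · next hinv =>
        exact finish (c.capCertL l) rfl rfl rfl (hcaps l (List.mem_of_getElem? hl)) (l.box_of_need dt fun r hr => hπ r (List.mem_append_right _ hr))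
          (c.payload_sound hinv dt fun r hr => hπ r (List.mem_append_left _ hr))
      · exact absurd hπ (not_nilRow _)
    · exact absurd hπ (not_nilRow _)
  | boxL j k =>
    simp only [StationCert.needD] at hπ
    split at hπ
    · next b l hb hl =>
      obtain ⟨hpay, -⟩ := hboxes b (List.mem_of_getElem? hb)
      have hv : (0 : ℝ) ≤ ((l.capLB * c.u - c.kfac * b.R : ℚ) : ℝ) := by
        simpa [linAt] using hπ _ (List.mem_append_right _ (List.mem_singleton.2 rfl))
      refine finish (c.capCertL l) rfl rfl rfl (hcaps l (List.mem_of_getElem? hl))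
        (l.box_of_need dt fun r hr => hπ r (List.mem_append_left _ (List.mem_append_right _ hr)))
        (hpay _ ?_ fun r hr => hπ r (List.mem_append_left _ (List.mem_append_left _ hr)))
      change ((c.kfac * b.R : ℚ) : ℝ) ≤ ((l.capLB * c.u : ℚ) : ℝ)
      push_cast at hv ⊢
      linarith
    · exact absurd hπ (not_nilRow _)

/-- ★★ **SOUNDNESS OF THE ρ-COVARIANT FLAT CHECKER** — the binders and the conclusion of 113L `StationCert.sound_dietXZ` VERBATIM. -/
theorem StationCert.sound_dietXZCov (c : StationCert) (X : DietCert) (extra : List LRow) (Bs : List BasisIdx)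
    (h : c.checkDXZCov X extra Bs = true) :
    ∀ ρ : ℝ, (c.R.rho0 : ℝ) ≤ ρ → ρ ≤ c.R.rho1 → ∀ dt : (Fin 3 → ℤ) → ℝ,
      (∀ q, castW c.R.lo q ≤ dt (holeVertex 0 q) ∧ dt (holeVertex 0 q) ≤ castW c.R.hi q) → ((c.R.loC : ℝ) ≤ dt 0 ∧ dt 0 ≤ c.R.hiC) →
      IsChartRealisable ρ dt → (∀ p ∈ stencil 0, 0 < dt p) → poleSum dt 0 ≤ poleSum dt 1 → poleSum dt 0 ≤ poleSum dt 2 →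
      (∀ a : Fin 3, dt (holeVertex 0 (a, true)) ≤ dt (holeVertex 0 (a, false))) → (∀ r ∈ extra, linAt r.a (sval dt) 0 ≤ (r.b : ℝ)) →
      feetHoleCost 160 (3 / 100) ρ dt 0 ≤ domCapK c.u 160 (3 / 100) ρ (chargeDepth ρ dt 0) := by
  simp only [StationCert.checkDXZCov, Bool.and_eq_true, decide_eq_true_eq, List.all_eq_true] at h
  obtain ⟨⟨⟨⟨⟨⟨hok, hρ0, hloC⟩, hboxes⟩, hcaps⟩, hc0⟩, hX⟩, htree⟩ := h
  intro ρ h₀ h₁ dt hbox hC hreal hpos hch1 hch2 hchp hextra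
  have hρ : 0 < ρ := lt_of_lt_of_le (by exact_mod_cast hρ0) h₀
  have hbox' : ∀ q, (c.R.lo q : ℝ) ≤ dt (holeVertex 0 q) ∧ dt (holeVertex 0 q) ≤ c.R.hi q := fun q => by simpa [castW_apply] using hbox q
  have h7 := c.R.box7 hbox' hC
  obtain ⟨hsl, hnn⟩ := c.diet_prelim hok hloC
  have hrows : ∀ r ∈ c.R.rows ++ chamberRows ++ X.rows ++ extra, linAt r.a (sval dt) 0 ≤ (r.b : ℝ) := fun r hr => by
    rcases List.mem_append.1 hr with hr | hr
    · rcases List.mem_append.1 hr with hr | hr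
      · rcases List.mem_append.1 hr with hr | hr
        · exact c.R.rows_sound hok h₀ h₁ hbox' hC hreal hpos r hr
        · exact chamberRows_sound dt hch1 hch2 hchp r hr
      · exact X.rows_sound hX hsl h7 r hr
    · exact hextra r hr
  obtain ⟨π, hπ⟩ := c.tree.sound_box c.needD c.R.bnd (sval dt) (c.R.bnd_sound h7 hnn) _ htree hrows
  have hboxesP : ∀ b ∈ c.boxes, (∀ capLB : ℚ, ((c.kfac * b.R : ℚ) : ℝ) ≤ ((capLB * c.u : ℚ) : ℝ) →
      (∀ r ∈ b.need, linAt r.a (sval dt) 0 ≤ (r.b : ℝ)) → (3 / 100 * (2 * (c.R.rho1 : ℝ))) ^ 2 * roofVal T75 (vtxW 160 dt 0) ≤ (capLB : ℝ) * c.u) ∧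
      c.kfac * b.R ≤ c.capLB * c.u := fun b hb => by
    obtain ⟨hbz, hv⟩ := Bool.and_eq_true_iff.1 (hboxes b hb)
    exact ⟨fun capLB hle hneed => c.box_payload_soundZ hbz hle dt hneed, of_decide_eq_true hv⟩
  refine c.sound_leafGCov (fun k => k.capCheckCov 0 = true) hboxesP hcaps hc0 hρ h₁ hbox (fun k e0 e1 eu k0 hb => ?_) hπ
  have hdom := capCheckCov_zero_chamber k0 hρ (e0 ▸ h₀ :) (e1 ▸ h₁ :) hb hch1 hch2
  rw [eu, e1] at hdom
  exact hdom

/-- ★★ THE SPHERE-CELL LAW from the ρ-covariant flat checker (113L `sphLaw_of_checkDXZ` twin, conclusion verbatim). -/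
theorem StationCert.sphLaw_of_checkDXZCov (c : StationCert) (X : DietCert) (cell : Box3) (Bs : List BasisIdx)
    (h : c.checkDXZCov X (sphRows cell c.R.rho0 c.R.rho1) Bs = true) :
    ∀ ρ : ℝ, (c.R.rho0 : ℝ) ≤ ρ → ρ ≤ c.R.rho1 → ∀ dt : (Fin 3 → ℤ) → ℝ,
      (∀ q, castW c.R.lo q ≤ dt (holeVertex 0 q) ∧ dt (holeVertex 0 q) ≤ castW c.R.hi q) → ((c.R.loC : ℝ) ≤ dt 0 ∧ dt 0 ≤ c.R.hiC) →
      IsChartRealisable ρ dt → (∀ p ∈ stencil 0, 0 < dt p) → poleSum dt 0 ≤ poleSum dt 1 → poleSum dt 0 ≤ poleSum dt 2 →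
      (∀ a : Fin 3, dt (holeVertex 0 (a, true)) ≤ dt (holeVertex 0 (a, false))) →
      (∀ a : Fin 3, dt (holeVertex 0 (a, true)) ^ 2 - dt 0 ^ 2 + 2 * (cell.lo a : ℝ) * c.R.rho0 * dt 0 ≤ (c.R.rho1 : ℝ) ^ 2) →
      (∀ (a : Fin 3) (b : Bool), dt (holeVertex 0 (a, b)) ^ 2 - dt 0 ^ 2 - 2 * (cell.hi a : ℝ) * c.R.rho1 * dt 0 ≤ (c.R.rho1 : ℝ) ^ 2) →
      feetHoleCost 160 (3 / 100) ρ dt 0 ≤ domCapK c.u 160 (3 / 100) ρ (chargeDepth ρ dt 0) :=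
  fun ρ h₀ h₁ dt hbox hC hreal hpos hch1 hch2 hchp hlo hhi =>
    c.sound_dietXZCov X _ Bs h ρ h₀ h₁ dt hbox hC hreal hpos hch1 hch2 hchp (sphRows_holds hlo hhi)

end Station

end Summit.AtomisticToContinuum.Crystallization.Theorems.ChargedEnergyGapChartDial
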